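import Literature.AlgebraicGeometry.GroupSchemes.BirationalGroupLawStrictification
import Literature.AlgebraicGeometry.Morphisms.SeparatedGluing
import Literature.AlgebraicGeometry.Limits.PushoutOpenImmersion
import Mathlib.AlgebraicGeometry.Morphisms.Smooth
import HarnessLib

/-!
# One gluing step of Weil's construction: `V′ = V ∪_{W_s} V_s` is a separated smooth `S`-scheme
# (Artin, *Néron models*, §2 p. 222; Conrad's gluing criterion)

Topic `Literature/AlgebraicGeometry/GroupSchemes`, namespace `Literature.AlgebraicGeometry.GroupSchemes`.
KERNEL ONLY: theorems; no definition, no named fact, no instance, no `sorry`.  Cell `hodgecm-mathlib` (D-0151),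
road W (Néron capital), piece (G2a) of the W1c design note (`A-provers/A-p06/W1c-DESIGN.A-p06g5.md`): the SCHEME
part of Artin's step — no group law involved.

Given an `S`-scheme `𝒱`, an open `A ⊆ 𝒱` and an open immersion `ρ : A ↪ 𝒱` over `S` (in the application: the
translate chart `a ↦ a·s` of `BirationalGroupLawTranslate`), glue two copies of `𝒱` by identifying `a ∈ A` in the
SECOND copy with `ρ a` in the FIRST copy: `𝒲 := 𝒱 ⊔_{A} 𝒱` (Mathlib's push-out of the two open immersions `ρ` and
`A ↪ 𝒱`; tree `Limits/PushoutOpenImmersion`).  Then ([Artin1986NeronModels] §2 p. 222 «`W_s` defines gluing data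
and yields a scheme `V′ = V ∪_{W_s} V_s`», with the separatedness supplied by [Conrad2007]'s criterion, tree
`Morphisms/SeparatedGluing.isSeparated_pushoutDesc`):

* `exists_selfGluing` — there are an `S`-scheme `𝒲` and open immersions `i₁ i₂ : 𝒱 ⟶ 𝒲` over `S`, jointly
  surjective, with `ρ ≫ i₁ = ι_A ≫ i₂`, meeting exactly in `i₁(ρ(A)) = i₂(A)`; `𝒲 → S` is smooth and quasi-compact
  when `𝒱 → S` is (and `S` affine-like: compact and quasi-separated), and SEPARATED when `𝒱 → S` is separated
  and the GRAPH of `ρ`, `(ρ, ι_A) : A → 𝒱 ×_S 𝒱`, has closed range ([Artin1986NeronModels] Lemma 2.3: `W_s` is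
  closed); if the fibres of `𝒱 → S` are preirreducible and `ρ(A)` is dense in every fibre, the fibres of
  `𝒲 → S` are preirreducible and `i₁(𝒱)`, `i₂(𝒱)` are dense in every fibre.

Sources: [Artin1986NeronModels] M. Artin, *Néron models*, in Cornell–Silverman (1986), §2 p. 222 (held,
`book:cornellnd-arithmetic-geometry` p0293); [Conrad2007] B. Conrad, *Deligne's notes on Nagata compactifications*,
J. Ramanujan Math. Soc. 22 (2007), Introduction (the tree file's source); [EdixhovenRomagny] Thm. 3.18 (4)
«Separation» (held).  HC_CM is not proved here; nothing here changes the floor.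

## References
* [Artin1986NeronModels] M. Artin, *Néron models*, in *Arithmetic Geometry*, Springer 1986, §2.
* [Conrad2007] B. Conrad, *Deligne's notes on Nagata compactifications*, J. Ramanujan Math. Soc. 22 (2007).
* [EdixhovenRomagny] B. Edixhoven, M. Romagny, Panor. Synthèses 47 (2015), Thm. 3.18.
-/

noncomputable section

namespace Literature.AlgebraicGeometry.GroupSchemes

open CategoryTheory CategoryTheory.Limits _root_.AlgebraicGeometry TopologicalSpace
open Literature.AlgebraicGeometry.Limits Literature.AlgebraicGeometry.Morphisms

universe u

variable {S : Scheme.{u}} (𝒱 : Over S) (A : 𝒱.left.Opens) (ρ : (A : Scheme.{u}) ⟶ 𝒱.left) [IsOpenImmersion ρ]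
  (hρ : ρ ≫ 𝒱.hom = A.ι ≫ 𝒱.hom)

/-- **Artin's gluing step, scheme part** ([Artin1986NeronModels] §2 p. 222: «`W_s` defines gluing data and yields a
scheme `V′ = V ∪_{W_s} V_s`»; separatedness by [Conrad2007]'s criterion = [Artin1986NeronModels] Lemma 2.3 «`W_s` is
closed»).  Glue two copies of the `S`-scheme `𝒱` along the open immersions `ρ : A ↪ 𝒱` (into the first copy) and
`A ↪ 𝒱` (into the second): the result `𝒲` is an `S`-scheme with open immersions `i₁, i₂ : 𝒱 → 𝒲` over `S`, jointly
surjective, `ρ ≫ i₁ = ι_A ≫ i₂`, overlapping exactly in `i₂(A)`; `𝒲 → S` is smooth, quasi-compact (for `S` compact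
and quasi-separated, e.g. affine) and — when the graph `(ρ, ι_A) : A → 𝒱 ×_S 𝒱` has CLOSED range — separated.
[cite: Artin1986NeronModels, §2 p. 222 and Lemma 2.3] [cite: Conrad2007, Introduction (gluing criterion)]
[cite: EdixhovenRomagny, Thm. 3.18 (4)] -/
theorem exists_selfGluing [Smooth 𝒱.hom] [IsSeparated 𝒱.hom] [CompactSpace 𝒱.left] [CompactSpace S]
    [QuasiSeparatedSpace S]
    (hclosed : IsClosed (Set.range (pullback.lift ρ A.ι (hρ.trans rfl) : (A : Scheme.{u}) ⟶
      pullback 𝒱.hom 𝒱.hom).base)) :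
    ∃ (𝒲 : Over S) (i₁ i₂ : 𝒱 ⟶ 𝒲), IsOpenImmersion i₁.left ∧ IsOpenImmersion i₂.left ∧
      ρ ≫ i₁.left = A.ι ≫ i₂.left ∧
      Set.range i₁.left.base ∪ Set.range i₂.left.base = Set.univ ∧
      Set.range i₁.left.base ∩ Set.range i₂.left.base = i₂.left.base '' (A : Set 𝒱.left) ∧
      Smooth 𝒲.hom ∧ IsSeparated 𝒲.hom ∧ QuasiCompact 𝒲.hom := by
  haveI := isOpenImmersion_inl ρ A.ι
  haveI := isOpenImmersion_inr ρ A.ι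
  have w : ρ ≫ 𝒱.hom = A.ι ≫ 𝒱.hom := hρ
  let p : pushout ρ A.ι ⟶ S := pushout.desc 𝒱.hom 𝒱.hom w
  let 𝒲 : Over S := Over.mk p
  let i₁ : 𝒱 ⟶ 𝒲 := Over.homMk (pushout.inl ρ A.ι) (pushout.inl_desc _ _ _)
  let i₂ : 𝒱 ⟶ 𝒲 := Over.homMk (pushout.inr ρ A.ι) (pushout.inr_desc _ _ _)
  refine ⟨𝒲, i₁, i₂, isOpenImmersion_inl ρ A.ι, isOpenImmersion_inr ρ A.ι, pushout.condition, ?_, ?_, ?_, ?_, ?_⟩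
  · exact range_inl_union_range_inr ρ A.ι
  · change Set.range (pushout.inl ρ A.ι).base ∩ Set.range (pushout.inr ρ A.ι).base =
      (pushout.inr ρ A.ι).base '' (A : Set 𝒱.left)
    rw [range_inl_inter_range_inr ρ A.ι, pushout.condition, ← Scheme.Opens.range_ι, ← Set.range_comp]
    rfl
  · exact of_isZariskiLocalAtSource_pushoutDesc ρ A.ι 𝒱.hom 𝒱.hom w @Smooth inferInstance inferInstance
  · exact isSeparated_pushoutDesc ρ A.ι 𝒱.hom 𝒱.hom w hclosed
  · exact quasiCompact_pushoutDesc ρ A.ι 𝒱.hom 𝒱.hom w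

/-! ## Fibres of the glued scheme -/

/-- Topology: a set covered by two preirreducible pieces, the first relatively open, with non-empty intersection is
preirreducible. [folklore] -/
private theorem isPreirreducible_of_union_relOpen {X : Type*} [TopologicalSpace X] {Z X₁ X₂ O₁ : Set X}
    (hO₁ : IsOpen O₁) (h₁ : X₁ = O₁ ∩ Z) (hZ : Z = X₁ ∪ X₂)
    (hX₁ : IsPreirreducible X₁) (hX₂ : IsPreirreducible X₂) (hne : (X₁ ∩ X₂).Nonempty) : IsPreirreducible Z := by
  have key : ∀ W : Set X, IsOpen W → (Z ∩ W).Nonempty → (X₁ ∩ W).Nonempty := by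
    rintro W hW ⟨z, hzZ, hzW⟩
    rw [hZ] at hzZ
    rcases hzZ with hz | hz
    · exact ⟨z, hz, hzW⟩
    · obtain ⟨y, hy₁, hy₂⟩ := hne
      obtain ⟨x, hxX₂, hxW, hxO₁⟩ := hX₂ W O₁ hW hO₁ ⟨z, hz, hzW⟩ ⟨y, hy₂, by rw [h₁] at hy₁; exact hy₁.1⟩
      refine ⟨x, ?_, hxW⟩
      rw [h₁]
      exact ⟨hxO₁, by rw [hZ]; exact Or.inr hxX₂⟩
  intro U V hU hV hZU hZV
  obtain ⟨x, hx, hxUV⟩ := hX₁ U V hU hV (key U hU hZU) (key V hV hZV)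
  exact ⟨x, by rw [hZ]; exact Or.inl hx, hxUV⟩

omit [IsOpenImmersion ρ] in
/-- **Fibres of the glued scheme.**  For `S`-morphisms `i₁, i₂ : 𝒱 → 𝒲` which are open immersions, jointly surjective,
with `ρ ≫ i₁ = ι_A ≫ i₂` (the gluing relation of `exists_selfGluing`): if the fibres of `𝒱 → S` are preirreducible and
`A` meets every non-empty fibre, then the fibres of `𝒲 → S` are preirreducible and `i₁(𝒱)`, `i₂(𝒱)` are dense in
every fibre of `𝒲 → S` ([Artin1986NeronModels] Lemma 2.4: «`V` is dense in each fibre of `V′`»).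
[cite: Artin1986NeronModels, Lemma 2.4 p. 222] -/
theorem isPreirreducible_fibre_of_selfGluing {𝒲 : Over S} (i₁ i₂ : 𝒱 ⟶ 𝒲) [IsOpenImmersion i₁.left]
    [IsOpenImmersion i₂.left] (hglue : ρ ≫ i₁.left = A.ι ≫ i₂.left)
    (hcover : Set.range i₁.left.base ∪ Set.range i₂.left.base = Set.univ)
    (hirr : ∀ t : S, IsPreirreducible (𝒱.hom.base ⁻¹' {t}))
    (hA : IsFibrewiseDense 𝒱.hom (A : Set 𝒱.left)) :
    (∀ t : S, IsPreirreducible (𝒲.hom.base ⁻¹' {t})) ∧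
      IsFibrewiseDense 𝒲.hom (Set.range i₁.left.base) ∧ IsFibrewiseDense 𝒲.hom (Set.range i₂.left.base) := by
  have hi₁ : ∀ v, 𝒲.hom.base (i₁.left.base v) = 𝒱.hom.base v := fun v => by
    change (i₁.left ≫ 𝒲.hom).base v = _; rw [Over.w i₁]
  have hi₂ : ∀ v, 𝒲.hom.base (i₂.left.base v) = 𝒱.hom.base v := fun v => by
    change (i₂.left ≫ 𝒲.hom).base v = _; rw [Over.w i₂]
  have hfib : ∀ t : S, 𝒲.hom.base ⁻¹' {t} =
      (Set.range i₁.left.base ∩ 𝒲.hom.base ⁻¹' {t}) ∪ (Set.range i₂.left.base ∩ 𝒲.hom.base ⁻¹' {t}) := by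
    intro t
    ext w
    constructor
    · intro hw
      have : w ∈ Set.range i₁.left.base ∪ Set.range i₂.left.base := by rw [hcover]; trivial
      rcases this with h | h
      · exact Or.inl ⟨h, hw⟩
      · exact Or.inr ⟨h, hw⟩
    · rintro (⟨-, hw⟩ | ⟨-, hw⟩) <;> exact hw
  have himg₁ : ∀ t : S, Set.range i₁.left.base ∩ 𝒲.hom.base ⁻¹' {t} = i₁.left.base '' (𝒱.hom.base ⁻¹' {t}) := by
    intro t; ext w; constructor
    · rintro ⟨⟨v, rfl⟩, hw⟩; exact ⟨v, by change 𝒱.hom.base v = t; rw [← hi₁]; exact hw, rfl⟩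
    · rintro ⟨v, hv, rfl⟩; exact ⟨⟨v, rfl⟩, by change 𝒲.hom.base (i₁.left.base v) = t; rw [hi₁]; exact hv⟩
  have himg₂ : ∀ t : S, Set.range i₂.left.base ∩ 𝒲.hom.base ⁻¹' {t} = i₂.left.base '' (𝒱.hom.base ⁻¹' {t}) := by
    intro t; ext w; constructor
    · rintro ⟨⟨v, rfl⟩, hw⟩; exact ⟨v, by change 𝒱.hom.base v = t; rw [← hi₂]; exact hw, rfl⟩
    · rintro ⟨v, hv, rfl⟩; exact ⟨⟨v, rfl⟩, by change 𝒲.hom.base (i₂.left.base v) = t; rw [hi₂]; exact hv⟩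
  have hirrW : ∀ t : S, IsPreirreducible (𝒲.hom.base ⁻¹' {t}) := by
    intro t
    by_cases ht : (𝒱.hom.base ⁻¹' {t}).Nonempty
    · obtain ⟨a₀, ha₀A, ha₀t⟩ := hA.nonempty_inter_fibre ht
      have : a₀ ∈ Set.range A.ι.base := by rw [Scheme.Opens.range_ι]; exact ha₀A
      obtain ⟨a, rfl⟩ := this
      refine isPreirreducible_of_union_relOpen i₁.left.isOpenEmbedding.isOpen_range rfl (hfib t) ?_ ?_ ?_
      · rw [himg₁]; exact (hirr t).image _ i₁.left.continuous.continuousOn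
      · rw [himg₂]; exact (hirr t).image _ i₂.left.continuous.continuousOn
      · refine ⟨i₂.left.base (A.ι.base a), ⟨⟨ρ.base a, ?_⟩, ?_⟩, ⟨A.ι.base a, rfl⟩, ?_⟩
        · change (ρ ≫ i₁.left).base a = (A.ι ≫ i₂.left).base a; rw [hglue]
        · change 𝒲.hom.base (i₂.left.base (A.ι.base a)) = t; rw [hi₂]; exact ha₀t
        · change 𝒲.hom.base (i₂.left.base (A.ι.base a)) = t; rw [hi₂]; exact ha₀t
    · -- empty fibre
      have hempty : 𝒲.hom.base ⁻¹' {t} = ∅ := by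
        rw [hfib t, himg₁, himg₂, Set.not_nonempty_iff_eq_empty.1 ht, Set.image_empty, Set.image_empty,
          Set.union_empty]
      rw [hempty]; exact isPreirreducible_empty
  refine ⟨hirrW, ?_, ?_⟩
  · refine IsFibrewiseDense.of_isOpen_of_forall_nonempty i₁.left.isOpenEmbedding.isOpen_range hirrW fun t ⟨w, hw⟩ => ?_
    have : w ∈ Set.range i₁.left.base ∪ Set.range i₂.left.base := by rw [hcover]; trivial
    rcases this with ⟨v, rfl⟩ | ⟨v, rfl⟩
    · exact ⟨_, ⟨v, rfl⟩, hw⟩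
    · exact ⟨i₁.left.base v, ⟨v, rfl⟩, by change 𝒲.hom.base (i₁.left.base v) = t; rw [hi₁, ← hi₂]; exact hw⟩
  · refine IsFibrewiseDense.of_isOpen_of_forall_nonempty i₂.left.isOpenEmbedding.isOpen_range hirrW fun t ⟨w, hw⟩ => ?_
    have : w ∈ Set.range i₁.left.base ∪ Set.range i₂.left.base := by rw [hcover]; trivial
    rcases this with ⟨v, rfl⟩ | ⟨v, rfl⟩
    · exact ⟨i₂.left.base v, ⟨v, rfl⟩, by change 𝒲.hom.base (i₂.left.base v) = t; rw [hi₂, ← hi₁]; exact hw⟩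
    · exact ⟨_, ⟨v, rfl⟩, hw⟩

end Literature.AlgebraicGeometry.GroupSchemes

end
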